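import Summits.QuantumFields.YangMills.Theorems.UnitScaleTiltProp7SectET3WilsonHessianT3Rows
import Literature.Analysis.Matrix.DetExp
import HarnessLib

/-!
# Route `UnitScaleTilt`, crux K1 child «MinimiserStabilityRegPr» (stmt-QuantumFields-19200), skeleton v10, stub `stub_existenceMinimalOrbit` (EX),
# route (α) — **THE SECOND Δ-SLOT ROW: PRINT'S WILSON HESSIAN `Δ^η(U₀)` PRESERVES THE TRACELESS SECTOR** (the mixed second derivative of the complexified Wilson action
# in a CENTRAL direction `c·1` and a traceless direction `Y` vanishes at every `SU(2)` background)

Cell `ym3-torus`, width seat `ym-ust-20520-w4` (gen 4).  THEOREMS ONLY (0 `def`, 0 `sorry`).  The row prover-ym-inputs-p01-0 left «OPEN for a successor» (`pub/ym-inputs/NOTES-p01-final.md`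
HANDOFF 11:25Z plan (1)–(5), followed here): the last displayed data row `hΔtr` of the (R-H) assembly ✓`Prop7H46RealityTrace`∕`Prop7DeltaEtaStarReality`.  Nothing here closes the stub;
`--supports stmt-QuantumFields-19200 --as helper`, count-neutral.  YM₃ on T³ is a ladder rung (R3), not the Clay problem; nothing here claims the stub, the crux, d = 4 or the gap.

THE PRINT.  [Balaban1985BackgroundPropagators] (3.7) p. 391 (the complexified action «interpret Re U(∂p) as ½(U(∂p) + U(−∂p))»), (3.10)–(3.12) p. 392 (`Δ(U₀)` «hermitian», acting on
`𝔤ᶜ = 𝔰𝔩₂`-valued functions).  On the cell's `M₂(ℂ) = 𝔰𝔩₂ ⊕ ℂ·1` carriers the `𝔰𝔩₂`-sector preservation is a THEOREM: a central exponent `s·c(b)·1` rescales every plaquette variable by the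
scalar `e^{sα_p}` (`α_p` = the signed sum of `c` around `∂p`) and its inverse by `e^{−sα_p}`, so `s ↦ A(e^{Z + s·c·1}U₀) = Σ_p (1 − ¼(e^{sα_p}·tr P_p(Z) + e^{−sα_p}·tr P_p(Z)⁻¹))`; along a
TRACELESS exponent `Z = tY` every `P_p` has `det = 1` (`det e^{tY} = e^{t·tr Y} = 1`, `det U₀ = 1`), hence `tr P⁻¹ = tr P` (2 × 2 adjugate) and the `s`-derivative at `0`,
`Σ_p −¼·α_p·(tr P − tr P⁻¹)`, VANISHES for every `t` — so the mixed second derivative `hessFormRe U₀ Y (c·1)` is `0`.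

WHAT IS PROVED (sorry-free, no definition).  §1 central scalars along transports (`holT_mul_of_central`, `holT_expUnit_smul_one`, `chartU_add_smul_one`, `plaqU_chartU_add_smul_one`);
§2 `det ↑(plaqU (chartU U₀ (t•Y)) p) = 1` for traceless `Y` and `tr P⁻¹ = tr P`; §3 the closed form of `s ↦ actionRe (chartU U₀ (Z + s•c•1))` and its `s`-derivative at `0`;
§4 ★★`hessFormRe_smul_one_eq_zero : hessFormRe U₀ (c•1) Y = 0` for traceless `Y`; §5 ★★★`trace_DeltaEta_toL2_eq_zero (hA : ∀ b, tr (A b) = 0) (b) : tr ((toL2⁻¹ (Δ^η(U₀) (toL2 A))) b) = 0` —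
the `hΔtr` binder of ✓`Prop7DeltaEtaStarReality.H46_skewHermitian_traceless_of_regPr` VERBATIM.

References: T. Bałaban, CMP 99 (1985) 389–434 [Balaban1985BackgroundPropagators] ((3.7) p.391, (3.10)–(3.12) p.392, p.393).
-/

set_option autoImplicit false

noncomputable section

open scoped InnerProductSpace ComplexConjugate Matrix.Norms.L2Operator BigOperators

namespace Summit.QuantumFields.YangMills.Theorems.Prop7WilsonHessianSectorRows

open Literature.MathematicalPhysics.QuantumFieldTheory.Balaban1983to89
open Literature.MathematicalPhysics.QuantumFieldTheory.Balaban1983to89.T3ContinuumYM3Torus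
open NormedSpace (exp)
open T3SectALandauChart (eta bgUnits)
open B9SectCLatticeCarrier (Bond)
open B11Eq103H1Complex (BondL2K)
open B10Eq27TorusAxialLog (holT holT_nil holT_cons_true holT_cons_false unitsField toUField)
open B7Prop1Explicit (expUnit val_expUnit val_inv_expUnit plaqWord Letter)
open Summit.QuantumFields.YangMills.Theorems.Prop7SectET3Transport (periodsT3)
open Summit.QuantumFields.YangMills.Theorems.Prop7SectET3HilbertLetters (W₂ toL2 inner_toL2)
open Summit.QuantumFields.YangMills.Theorems.Prop7SectET3WilsonHessian (chartU plaqU actionRe hessFormRe hessSesqRe DeltaEta actionRe_def plaqU_def val_chartU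
  contDiff_actionRe_chartU hessFormRe_symm hessSesqRe_apply inner_DeltaEta_left)

/-! ## §1 Central scalars along parallel transports -/

section Central

variable {P : Params} {j : ℕ} {G : Type*} [Group G]

/-- A transport of CENTRAL bond variables is central. [folklore] -/
theorem holT_commute_of_central (u : GaugeField P j G) (hu : ∀ b g, Commute (u b) g) :
    ∀ (x : Site P j) (w : List (Letter P.d)) (g : G), Commute (holT u x w) g
  | x, [], g => by rw [holT_nil]; exact Commute.one_left g
  | x, (μ, true) :: w, g => by rw [holT_cons_true]; exact (hu _ g).mul_left (holT_commute_of_central u hu _ w g)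
  | x, (μ, false) :: w, g => by rw [holT_cons_false]; exact (hu _ g).inv_left.mul_left (holT_commute_of_central u hu _ w g)

/-- **TRANSPORT OF A CENTRALLY RESCALED CONFIGURATION**: `(u·V)(Γ) = u(Γ)·V(Γ)` when every `u(b)` is central. [cite: Balaban1985Averaging, (9) p.18] -/
theorem holT_mul_of_central (u V : GaugeField P j G) (hu : ∀ b g, Commute (u b) g) :
    ∀ (x : Site P j) (w : List (Letter P.d)), holT (fun b => u b * V b) x w = holT u x w * holT V x w
  | x, [] => by simp only [holT_nil, mul_one]
  | x, (μ, true) :: w => by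
      rw [holT_cons_true, holT_cons_true, holT_cons_true, holT_mul_of_central u V hu]
      have hc := (holT_commute_of_central u hu (x.shift μ) w (V ⟨x, μ⟩)).eq
      calc u ⟨x, μ⟩ * V ⟨x, μ⟩ * (holT u (x.shift μ) w * holT V (x.shift μ) w)
          = u ⟨x, μ⟩ * (V ⟨x, μ⟩ * holT u (x.shift μ) w) * holT V (x.shift μ) w := by simp only [mul_assoc]
        _ = u ⟨x, μ⟩ * (holT u (x.shift μ) w * V ⟨x, μ⟩) * holT V (x.shift μ) w := by rw [hc]
        _ = u ⟨x, μ⟩ * holT u (x.shift μ) w * (V ⟨x, μ⟩ * holT V (x.shift μ) w) := by simp only [mul_assoc]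
  | x, (μ, false) :: w => by
      rw [holT_cons_false, holT_cons_false, holT_cons_false, holT_mul_of_central u V hu, mul_inv_rev]
      have hc := (holT_commute_of_central u hu (x.unshift μ) w (V ⟨x.unshift μ, μ⟩)⁻¹).eq
      have hc' := ((hu ⟨x.unshift μ, μ⟩ (V ⟨x.unshift μ, μ⟩)⁻¹).inv_left).eq
      calc (V ⟨x.unshift μ, μ⟩)⁻¹ * (u ⟨x.unshift μ, μ⟩)⁻¹ * (holT u (x.unshift μ) w * holT V (x.unshift μ) w)
          = (u ⟨x.unshift μ, μ⟩)⁻¹ * ((V ⟨x.unshift μ, μ⟩)⁻¹ * holT u (x.unshift μ) w) * holT V (x.unshift μ) w := by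
            rw [← hc']; simp only [mul_assoc]
        _ = (u ⟨x.unshift μ, μ⟩)⁻¹ * (holT u (x.unshift μ) w * (V ⟨x.unshift μ, μ⟩)⁻¹) * holT V (x.unshift μ) w := by rw [hc]
        _ = (u ⟨x.unshift μ, μ⟩)⁻¹ * holT u (x.unshift μ) w * ((V ⟨x.unshift μ, μ⟩)⁻¹ * holT V (x.unshift μ) w) := by simp only [mul_assoc]

end Central

/-! ## §2 The central exponential units `e^{z·1}` of `M₂(ℂ)` -/

section Scalars

/-- `e^{z·1} = e^z·1` as a matrix. [folklore] -/
theorem val_expUnit_smul_one (z : ℂ) : ((expUnit (z • (1 : Matrix (Fin 2) (Fin 2) ℂ)) : (Matrix (Fin 2) (Fin 2) ℂ)ˣ) : Matrix (Fin 2) (Fin 2) ℂ) = Complex.exp z • (1 : Matrix (Fin 2) (Fin 2) ℂ) := by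
  rw [val_expUnit, ← Algebra.algebraMap_eq_smul_one, ← Algebra.algebraMap_eq_smul_one, Complex.exp_eq_exp_ℂ]
  exact (NormedSpace.algebraMap_exp_comm (𝔸 := Matrix (Fin 2) (Fin 2) ℂ) z).symm

/-- … and its inverse is `e^{−z}·1`. [folklore] -/
theorem val_inv_expUnit_smul_one (z : ℂ) :
    (((expUnit (z • (1 : Matrix (Fin 2) (Fin 2) ℂ)))⁻¹ : (Matrix (Fin 2) (Fin 2) ℂ)ˣ) : Matrix (Fin 2) (Fin 2) ℂ) = Complex.exp (-z) • (1 : Matrix (Fin 2) (Fin 2) ℂ) := by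
  rw [val_inv_expUnit, ← neg_smul, val_expUnit_smul_one]

/-- `e^{z·1}` is central among the units. [folklore] -/
theorem commute_expUnit_smul_one (z : ℂ) (g : (Matrix (Fin 2) (Fin 2) ℂ)ˣ) : Commute (expUnit (z • (1 : Matrix (Fin 2) (Fin 2) ℂ))) g := by
  rw [Commute, SemiconjBy, Units.ext_iff, Units.val_mul, Units.val_mul, val_expUnit_smul_one, smul_mul_assoc, one_mul, mul_smul_comm, mul_one]

/-- **`e^{X + z·1} = e^{z·1}·e^{X}`** (the summands commute). [folklore] -/
theorem expUnit_add_smul_one (X : Matrix (Fin 2) (Fin 2) ℂ) (z : ℂ) :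
    expUnit (X + z • (1 : Matrix (Fin 2) (Fin 2) ℂ)) = expUnit (z • (1 : Matrix (Fin 2) (Fin 2) ℂ)) * expUnit X := by
  letI : NormedAlgebra ℚ (Matrix (Fin 2) (Fin 2) ℂ) := NormedAlgebra.restrictScalars ℚ ℂ (Matrix (Fin 2) (Fin 2) ℂ)
  apply Units.ext
  rw [Units.val_mul, val_expUnit, val_expUnit, val_expUnit, add_comm]
  exact NormedSpace.exp_add_of_commute ((Commute.one_left X).smul_left z)

variable {P : Params} {j : ℕ}

/-- **TRANSPORT OF THE CENTRAL CONFIGURATION `b ↦ e^{s·c(b)·1}` IS `e^{s·α}·1`** with `α` the signed sum of `c` along the word (existential form, linear in `s`; inverse `e^{−s·α}·1`).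
[cite: Balaban1985Averaging, (9) p.18] -/
theorem holT_expUnit_smul_one (c : PBond P j → ℂ) :
    ∀ (x : Site P j) (w : List (Letter P.d)), ∃ α : ℂ, ∀ s : ℂ,
      ((holT (fun b => expUnit ((s * c b) • (1 : Matrix (Fin 2) (Fin 2) ℂ))) x w : (Matrix (Fin 2) (Fin 2) ℂ)ˣ) : Matrix (Fin 2) (Fin 2) ℂ) = Complex.exp (s * α) • 1 ∧
      (((holT (fun b => expUnit ((s * c b) • (1 : Matrix (Fin 2) (Fin 2) ℂ))) x w)⁻¹ : (Matrix (Fin 2) (Fin 2) ℂ)ˣ) : Matrix (Fin 2) (Fin 2) ℂ) = Complex.exp (-(s * α)) • 1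
  | x, [] => ⟨0, fun s => by simp⟩
  | x, (μ, true) :: w => by
      obtain ⟨α, hα⟩ := holT_expUnit_smul_one c (x.shift μ) w
      refine ⟨c ⟨x, μ⟩ + α, fun s => ⟨?_, ?_⟩⟩
      · rw [holT_cons_true, Units.val_mul, (hα s).1, val_expUnit_smul_one, smul_mul_assoc, one_mul, smul_smul, ← Complex.exp_add, mul_add]
      · rw [holT_cons_true, mul_inv_rev, Units.val_mul, (hα s).2, val_inv_expUnit_smul_one, smul_mul_assoc, one_mul, smul_smul, ← Complex.exp_add]
        congr 2; ring
  | x, (μ, false) :: w => by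
      obtain ⟨α, hα⟩ := holT_expUnit_smul_one c (x.unshift μ) w
      refine ⟨-c ⟨x.unshift μ, μ⟩ + α, fun s => ⟨?_, ?_⟩⟩
      · rw [holT_cons_false, Units.val_mul, (hα s).1, val_inv_expUnit_smul_one, smul_mul_assoc, one_mul, smul_smul, ← Complex.exp_add]
        congr 2; ring
      · rw [holT_cons_false, mul_inv_rev, inv_inv, Units.val_mul, (hα s).2, val_expUnit_smul_one, smul_mul_assoc, one_mul, smul_smul, ← Complex.exp_add]
        congr 2; ring

end Scalars

/-! ## §3 The chart along `Z + s·c·1`: plaquettes rescale centrally; the closed form of the action and its `s`-derivative -/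

variable {F : T3Family} {K : ℕ}

/-- **THE CHART FACTORISES ALONG A CENTRAL DIRECTION**: `e^{Z + s·c·1}U₀ = e^{s·c·1}·(e^{Z}U₀)` bondwise. [cite: Balaban1985BackgroundPropagators, (3.6) p.391] -/
theorem chartU_add_smul_one (U₀ : GaugeField (F.P K) 0 (Matrix.specialUnitaryGroup (Fin 2) ℂ)) (Z : PBond (F.P K) 0 → Matrix (Fin 2) (Fin 2) ℂ) (c : PBond (F.P K) 0 → ℂ) (s : ℂ) :
    chartU F K U₀ (Z + s • fun b => c b • (1 : Matrix (Fin 2) (Fin 2) ℂ)) =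
      fun b => expUnit ((s * c b) • (1 : Matrix (Fin 2) (Fin 2) ℂ)) * chartU F K U₀ Z b := by
  funext b
  rw [chartU, chartU, Pi.add_apply, Pi.smul_apply, smul_smul, expUnit_add_smul_one, mul_assoc]

/-- **PLAQUETTE VARIABLES RESCALE CENTRALLY**: `(e^{Z+s·c·1}U₀)(∂p) = h_p(s)·(e^{Z}U₀)(∂p)` with `h_p(s)` the transport of `b ↦ e^{s·c(b)·1}` around `∂p`.
[cite: Balaban1985BackgroundPropagators, (3.7) p.391] -/
theorem plaqU_chartU_add_smul_one (U₀ : GaugeField (F.P K) 0 (Matrix.specialUnitaryGroup (Fin 2) ℂ)) (Z : PBond (F.P K) 0 → Matrix (Fin 2) (Fin 2) ℂ) (c : PBond (F.P K) 0 → ℂ)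
    (s : ℂ) (p : Plaq (F.P K) 0) :
    plaqU F K (chartU F K U₀ (Z + s • fun b => c b • (1 : Matrix (Fin 2) (Fin 2) ℂ))) p =
      holT (fun b => expUnit ((s * c b) • (1 : Matrix (Fin 2) (Fin 2) ℂ))) p.src (plaqWord p.μ p.ν) * plaqU F K (chartU F K U₀ Z) p := by
  rw [plaqU_def, plaqU_def, chartU_add_smul_one]
  exact holT_mul_of_central _ _ (fun b g => commute_expUnit_smul_one _ g) _ _

/-- **THE COMPLEXIFIED ACTION ALONG A CENTRAL DIRECTION, CLOSED FORM**: for every exponent field `Z` and scalar field `c` there are phases `α_p` with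
`A(e^{Z + s·c·1}U₀) = Σ_p (1 − ¼(e^{sα_p}·tr P_p + e^{−sα_p}·tr P_p⁻¹))` for all `s`, `P_p = (e^{Z}U₀)(∂p)`. [cite: Balaban1985BackgroundPropagators, (3.7) p.391] -/
theorem actionRe_chartU_add_smul_one (U₀ : GaugeField (F.P K) 0 (Matrix.specialUnitaryGroup (Fin 2) ℂ)) (Z : PBond (F.P K) 0 → Matrix (Fin 2) (Fin 2) ℂ) (c : PBond (F.P K) 0 → ℂ) :
    ∃ α : Plaq (F.P K) 0 → ℂ, ∀ s : ℂ,
      actionRe F K (chartU F K U₀ (Z + s • fun b => c b • (1 : Matrix (Fin 2) (Fin 2) ℂ))) =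
        ∑ p : Plaq (F.P K) 0, (1 - (4 : ℂ)⁻¹ * (Complex.exp (s * α p) * Matrix.trace ((plaqU F K (chartU F K U₀ Z) p : (Matrix (Fin 2) (Fin 2) ℂ)ˣ) : Matrix (Fin 2) (Fin 2) ℂ) +
          Complex.exp (-(s * α p)) * Matrix.trace (((plaqU F K (chartU F K U₀ Z) p)⁻¹ : (Matrix (Fin 2) (Fin 2) ℂ)ˣ) : Matrix (Fin 2) (Fin 2) ℂ))) := by
  choose α hα using fun p : Plaq (F.P K) 0 => holT_expUnit_smul_one (P := F.P K) (j := 0) c p.src (plaqWord p.μ p.ν)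
  refine ⟨α, fun s => ?_⟩
  rw [actionRe_def]
  refine Finset.sum_congr rfl fun p _ => ?_
  rw [plaqU_chartU_add_smul_one, mul_inv_rev, Units.val_mul, Units.val_mul, (hα p s).1, (hα p s).2, smul_mul_assoc, one_mul, Matrix.trace_smul, smul_eq_mul,
    Matrix.mul_smul, Matrix.mul_one, Matrix.trace_smul, smul_eq_mul]

/-! ## §4 Along a traceless exponent every plaquette variable has determinant one, hence `tr P⁻¹ = tr P` -/

section Det

variable {P : Params} {j : ℕ}

/-- A transport of determinant-one bond variables has determinant one. [folklore] -/
theorem det_holT_eq_one (W : GaugeField P j (Matrix (Fin 2) (Fin 2) ℂ)ˣ) (hW : ∀ b, ((W b : (Matrix (Fin 2) (Fin 2) ℂ)ˣ) : Matrix (Fin 2) (Fin 2) ℂ).det = 1) :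
    ∀ (x : Site P j) (w : List (Letter P.d)), ((holT W x w : (Matrix (Fin 2) (Fin 2) ℂ)ˣ) : Matrix (Fin 2) (Fin 2) ℂ).det = 1
  | x, [] => by rw [holT_nil, Units.val_one, Matrix.det_one]
  | x, (μ, true) :: w => by rw [holT_cons_true, Units.val_mul, Matrix.det_mul, hW, det_holT_eq_one W hW, one_mul]
  | x, (μ, false) :: w => by
      have hinv : (((W ⟨x.unshift μ, μ⟩)⁻¹ : (Matrix (Fin 2) (Fin 2) ℂ)ˣ) : Matrix (Fin 2) (Fin 2) ℂ).det = 1 := by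
        have h := congrArg Matrix.det (W ⟨x.unshift μ, μ⟩).inv_mul
        rwa [Matrix.det_mul, hW, mul_one, Matrix.det_one] at h
      rw [holT_cons_false, Units.val_mul, Matrix.det_mul, hinv, det_holT_eq_one W hW, one_mul]

/-- For a `2 × 2` unit of determinant one, `tr P⁻¹ = tr P` (`P⁻¹ = adj P`). [folklore] -/
theorem trace_inv_eq_trace_of_det_eq_one (u : (Matrix (Fin 2) (Fin 2) ℂ)ˣ) (hu : ((u : (Matrix (Fin 2) (Fin 2) ℂ)ˣ) : Matrix (Fin 2) (Fin 2) ℂ).det = 1) :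
    (((u⁻¹ : (Matrix (Fin 2) (Fin 2) ℂ)ˣ) : Matrix (Fin 2) (Fin 2) ℂ)).trace = ((u : (Matrix (Fin 2) (Fin 2) ℂ)ˣ) : Matrix (Fin 2) (Fin 2) ℂ).trace := by
  rw [Matrix.coe_units_inv, Matrix.inv_def, hu, Ring.inverse_one, one_smul, Matrix.adjugate_fin_two, Matrix.trace_fin_two, Matrix.trace_fin_two]
  simp only [Matrix.of_apply, Matrix.cons_val', Matrix.cons_val_zero, Matrix.cons_val_one, Matrix.cons_val_fin_one, Matrix.empty_val']
  ring

end Det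

/-- **ALONG A TRACELESS EXPONENT THE CHART IS `SL₂`-VALUED**: `det (e^{tY(b)}U₀(b)) = e^{t·tr Y(b)}·det U₀(b) = 1`. [cite: Balaban1985BackgroundPropagators, (3.6) p.391] -/
theorem det_chartU_smul_eq_one (U₀ : GaugeField (F.P K) 0 (Matrix.specialUnitaryGroup (Fin 2) ℂ)) (Y : PBond (F.P K) 0 → Matrix (Fin 2) (Fin 2) ℂ) (hY : ∀ b, (Y b).trace = 0)
    (t : ℂ) (b : PBond (F.P K) 0) : ((chartU F K U₀ (t • Y) b : (Matrix (Fin 2) (Fin 2) ℂ)ˣ) : Matrix (Fin 2) (Fin 2) ℂ).det = 1 := by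
  have hU : (((bgUnits F K U₀ b : (Matrix (Fin 2) (Fin 2) ℂ)ˣ) : Matrix (Fin 2) (Fin 2) ℂ)).det = 1 := (Matrix.mem_specialUnitaryGroup_iff.1 (U₀ b).2).2
  rw [val_chartU, Matrix.det_mul, hU, mul_one, Literature.Analysis.Matrix.det_exp_eq_exp_trace, Pi.smul_apply, Matrix.trace_smul, hY, smul_zero, NormedSpace.exp_zero]

/-- **… HENCE EVERY PLAQUETTE VARIABLE ALONG `tY` SATISFIES `tr P⁻¹ = tr P`.** [cite: Balaban1985BackgroundPropagators, (3.7) p.391] -/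
theorem trace_plaqU_inv_eq_of_traceless (U₀ : GaugeField (F.P K) 0 (Matrix.specialUnitaryGroup (Fin 2) ℂ)) (Y : PBond (F.P K) 0 → Matrix (Fin 2) (Fin 2) ℂ) (hY : ∀ b, (Y b).trace = 0)
    (t : ℂ) (p : Plaq (F.P K) 0) :
    ((((plaqU F K (chartU F K U₀ (t • Y)) p)⁻¹ : (Matrix (Fin 2) (Fin 2) ℂ)ˣ) : Matrix (Fin 2) (Fin 2) ℂ)).trace =
      ((plaqU F K (chartU F K U₀ (t • Y)) p : (Matrix (Fin 2) (Fin 2) ℂ)ˣ) : Matrix (Fin 2) (Fin 2) ℂ).trace :=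
  trace_inv_eq_trace_of_det_eq_one _ (by rw [plaqU_def]; exact det_holT_eq_one _ (det_chartU_smul_eq_one U₀ Y hY t) _ _)

/-! ## §5 The action is EVEN in the central parameter along a traceless exponent; the first `s`-derivative vanishes -/

/-- **`s ↦ A(e^{tY + s·c·1}U₀)` IS EVEN** for traceless `Y` (closed form of §3 with `tr P⁻¹ = tr P`). [cite: Balaban1985BackgroundPropagators, (3.7) p.391] -/
theorem actionRe_chartU_smul_add_neg_smul_one (U₀ : GaugeField (F.P K) 0 (Matrix.specialUnitaryGroup (Fin 2) ℂ)) (Y : PBond (F.P K) 0 → Matrix (Fin 2) (Fin 2) ℂ)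
    (hY : ∀ b, (Y b).trace = 0) (c : PBond (F.P K) 0 → ℂ) (t s : ℂ) :
    actionRe F K (chartU F K U₀ (t • Y + (-s) • fun b => c b • (1 : Matrix (Fin 2) (Fin 2) ℂ))) =
      actionRe F K (chartU F K U₀ (t • Y + s • fun b => c b • (1 : Matrix (Fin 2) (Fin 2) ℂ))) := by
  obtain ⟨α, hα⟩ := actionRe_chartU_add_smul_one U₀ (t • Y) c
  rw [hα, hα]
  refine Finset.sum_congr rfl fun p _ => ?_
  rw [trace_plaqU_inv_eq_of_traceless U₀ Y hY t p, neg_mul, neg_neg, add_comm (Complex.exp (-(s * α p)) * _)]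

/-- **THE FIRST `s`-DERIVATIVE VANISHES: `D A(e^{·}U₀)(tY)[c·1] = 0`** for traceless `Y` (an even differentiable function has derivative `0` at `0`).
[cite: Balaban1985BackgroundPropagators, (3.7) p.391, (3.12) p.392] -/
theorem fderiv_actionRe_chartU_smul_apply_smul_one (U₀ : GaugeField (F.P K) 0 (Matrix.specialUnitaryGroup (Fin 2) ℂ)) (Y : PBond (F.P K) 0 → Matrix (Fin 2) (Fin 2) ℂ)
    (hY : ∀ b, (Y b).trace = 0) (c : PBond (F.P K) 0 → ℂ) (t : ℂ) :
    fderiv ℂ (fun X : PBond (F.P K) 0 → Matrix (Fin 2) (Fin 2) ℂ => actionRe F K (chartU F K U₀ X)) (t • Y) (fun b => c b • (1 : Matrix (Fin 2) (Fin 2) ℂ)) = 0 := by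
  set f : (PBond (F.P K) 0 → Matrix (Fin 2) (Fin 2) ℂ) → ℂ := fun X => actionRe F K (chartU F K U₀ X) with hf_def
  set C : PBond (F.P K) 0 → Matrix (Fin 2) (Fin 2) ℂ := fun b => c b • (1 : Matrix (Fin 2) (Fin 2) ℂ) with hC_def
  have hf : DifferentiableAt ℂ f (t • Y) := ((contDiff_actionRe_chartU U₀).differentiable (by simp)).differentiableAt
  -- the line `s ↦ tY + sC` and the derivative of `f` along it
  have hpath : HasDerivAt (fun s : ℂ => t • Y + s • C) C 0 := by
    simpa using ((hasDerivAt_id (0 : ℂ)).smul_const C).const_add (t • Y)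
  have hφ : HasDerivAt (fun s : ℂ => f (t • Y + s • C)) (fderiv ℂ f (t • Y) C) 0 :=
    hf.hasFDerivAt.comp_hasDerivAt_of_eq (0 : ℂ) hpath (by simp)
  -- the same line traversed backwards has the SAME values (evenness) and derivative `−(…)`
  have hneg : HasDerivAt (fun s : ℂ => -s) (-1) 0 := by simpa using hasDerivAt_neg (0 : ℂ)
  have hφ' : HasDerivAt (fun s : ℂ => f (t • Y + s • C)) (fderiv ℂ f (t • Y) C) (-0) := by rw [neg_zero]; exact hφ
  have hψ : HasDerivAt (fun s : ℂ => f (t • Y + (-s) • C)) (fderiv ℂ f (t • Y) C * (-1)) 0 := hφ'.comp (0 : ℂ) hneg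
  have heq : (fun s : ℂ => f (t • Y + (-s) • C)) = fun s : ℂ => f (t • Y + s • C) :=
    funext fun s => actionRe_chartU_smul_add_neg_smul_one U₀ Y hY c t s
  rw [heq] at hψ
  have h := hφ.unique hψ
  have h2 : (2 : ℂ) * fderiv ℂ f (t • Y) C = 0 := by linear_combination h
  exact (mul_eq_zero.1 h2).resolve_left two_ne_zero

/-! ## §6 The mixed second derivative `hessFormRe U₀ (c·1) Y` vanishes for traceless `Y` -/

/-- ★★ **THE HESSIAN LETTER KILLS (CENTRAL, TRACELESS) PAIRS**: `hessFormRe U₀ (c·1) Y = 0 = hessFormRe U₀ Y (c·1)` for traceless `Y` (the first derivative along `c·1` vanishes identically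
in `t` along `tY`, §5; differentiate in `t` at `0`; Schwarz symmetry ✓`hessFormRe_symm`). [cite: Balaban1985BackgroundPropagators, (3.12) p.392] -/
theorem hessFormRe_apply_smul_one_eq_zero (U₀ : GaugeField (F.P K) 0 (Matrix.specialUnitaryGroup (Fin 2) ℂ)) (Y : PBond (F.P K) 0 → Matrix (Fin 2) (Fin 2) ℂ) (hY : ∀ b, (Y b).trace = 0)
    (c : PBond (F.P K) 0 → ℂ) :
    hessFormRe F K U₀ Y (fun b => c b • (1 : Matrix (Fin 2) (Fin 2) ℂ)) = 0 ∧ hessFormRe F K U₀ (fun b => c b • (1 : Matrix (Fin 2) (Fin 2) ℂ)) Y = 0 := by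
  set f : (PBond (F.P K) 0 → Matrix (Fin 2) (Fin 2) ℂ) → ℂ := fun X => actionRe F K (chartU F K U₀ X) with hf_def
  set C : PBond (F.P K) 0 → Matrix (Fin 2) (Fin 2) ℂ := fun b => c b • (1 : Matrix (Fin 2) (Fin 2) ℂ) with hC_def
  -- the first derivative `F₂ = Df` is differentiable (f is smooth)
  have hF₂ : DifferentiableAt ℂ (fun X => fderiv ℂ f X) 0 :=
    (((contDiff_actionRe_chartU U₀).fderiv_right (m := ⊤) le_top).differentiable (by simp)).differentiableAt
  -- `g := Df(·)[C]` has `Dg(0)[Y] = D²f(0)[Y][C] = hessFormRe Y C`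
  have hg : HasFDerivAt (fun X => fderiv ℂ f X C) ((ContinuousLinearMap.apply ℂ ℂ C).comp (fderiv ℂ (fun X => fderiv ℂ f X) 0)) 0 :=
    (ContinuousLinearMap.apply ℂ ℂ C).hasFDerivAt.comp 0 hF₂.hasFDerivAt
  -- along the line `t ↦ tY` the function `g` vanishes identically (§5), so `Dg(0)[Y] = 0`
  have hpath : HasDerivAt (fun t : ℂ => t • Y) Y 0 := by simpa using (hasDerivAt_id (0 : ℂ)).smul_const Y
  have hline : HasDerivAt (fun t : ℂ => fderiv ℂ f (t • Y) C) (((ContinuousLinearMap.apply ℂ ℂ C).comp (fderiv ℂ (fun X => fderiv ℂ f X) 0)) Y) 0 :=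
    hg.comp_hasDerivAt_of_eq (0 : ℂ) hpath (by simp)
  have hzero : (fun t : ℂ => fderiv ℂ f (t • Y) C) = fun _ => 0 := funext fun t => fderiv_actionRe_chartU_smul_apply_smul_one U₀ Y hY c t
  rw [hzero] at hline
  have h0 : ((ContinuousLinearMap.apply ℂ ℂ C).comp (fderiv ℂ (fun X => fderiv ℂ f X) 0)) Y = 0 := (hasDerivAt_const (0 : ℂ) (0 : ℂ)).unique hline ▸ rfl
  have hYC : hessFormRe F K U₀ Y C = 0 := by
    rw [ContinuousLinearMap.comp_apply, ContinuousLinearMap.apply_apply] at h0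
    exact h0
  exact ⟨hYC, by rw [hessFormRe_symm]; exact hYC⟩

/-! ## §7 The row: `Δ^η(U₀)` maps traceless fields to traceless fields -/

variable {n : ℕ} {c₀ : ℝ} [Fact (0 < c₀)]

/-- ★★★ **THE SECOND Δ-SLOT ROW — `Δ^η(U₀)` PRESERVES THE TRACELESS SECTOR**: for a traceless-valued fine field `A`, `toL2⁻¹(Δ^η(U₀)(toL2 A))` is traceless-valued — the `hΔtr` binder of
✓`Prop7DeltaEtaStarReality.H46_skewHermitian_traceless_of_regPr` VERBATIM (test against the scalar field supported at one bond: `⟪Δ^η(toL2 A), toL2 δ_b·1⟫ = k·hessFormRe U₀ Aᴴ (δ_b·1) = 0`,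
while the same pairing is `c₀·conj tr (toL2⁻¹Δ^η(toL2 A))(b)` by ✓`inner_toL2`). [cite: Balaban1985BackgroundPropagators, (3.10)–(3.12) p.392, p.393] -/
theorem trace_DeltaEta_toL2_eq_zero (U₀ : GaugeField (F.P K) 0 (Matrix.specialUnitaryGroup (Fin 2) ℂ)) (A : PBond (F.P K) 0 → Matrix (Fin 2) (Fin 2) ℂ)
    (hA : ∀ b, (A b).trace = 0) (b : PBond (F.P K) 0) : ((toL2 F K c₀).symm (DeltaEta F n K c₀ U₀ (toL2 F K c₀ A)) b).trace = 0 := by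
  set G : PBond (F.P K) 0 → Matrix (Fin 2) (Fin 2) ℂ := (toL2 F K c₀).symm (DeltaEta F n K c₀ U₀ (toL2 F K c₀ A)) with hG_def
  have hGL : DeltaEta F n K c₀ U₀ (toL2 F K c₀ A) = toL2 F K c₀ G := by rw [hG_def, LinearEquiv.apply_symm_apply]
  -- the scalar test field supported at `b`
  have hsingle : (Pi.single b (1 : Matrix (Fin 2) (Fin 2) ℂ) : PBond (F.P K) 0 → Matrix (Fin 2) (Fin 2) ℂ) = fun b' => (Pi.single b (1 : ℂ) : PBond (F.P K) 0 → ℂ) b' • (1 : Matrix (Fin 2) (Fin 2) ℂ) := by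
    funext b'
    by_cases hb : b' = b
    · subst hb; rw [Pi.single_eq_same, Pi.single_eq_same, one_smul]
    · rw [Pi.single_eq_of_ne hb, Pi.single_eq_of_ne hb, zero_smul]
  have hAstar : ∀ b', (star A b').trace = 0 := fun b' => by rw [Pi.star_apply, Matrix.star_eq_conjTranspose, Matrix.trace_conjTranspose, hA, star_zero]
  -- the pairing with the test field, computed twice
  have h1 : ⟪DeltaEta F n K c₀ U₀ (toL2 F K c₀ A), toL2 F K c₀ (Pi.single b (1 : Matrix (Fin 2) (Fin 2) ℂ))⟫_ℂ = 0 := by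
    rw [inner_DeltaEta_left, hessSesqRe_apply, LinearEquiv.symm_apply_apply, LinearEquiv.symm_apply_apply, hsingle,
      (hessFormRe_apply_smul_one_eq_zero U₀ (star A) hAstar _).1, mul_zero]
  have h2 : ⟪DeltaEta F n K c₀ U₀ (toL2 F K c₀ A), toL2 F K c₀ (Pi.single b (1 : Matrix (Fin 2) (Fin 2) ℂ))⟫_ℂ = (c₀ : ℂ) * star (G b).trace := by
    rw [hGL, inner_toL2, Finset.sum_eq_single b (fun b' _ hb' => by rw [Pi.single_eq_of_ne hb', Matrix.mul_zero, Matrix.trace_zero]) (fun hb => (hb (Finset.mem_univ b)).elim),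
      Pi.single_eq_same, Matrix.mul_one, Matrix.trace_conjTranspose]
  rw [h2] at h1
  have hc₀ : ((c₀ : ℝ) : ℂ) ≠ 0 := Complex.ofReal_ne_zero.2 (ne_of_gt (Fact.out : 0 < c₀))
  have hst : star (G b).trace = 0 := (mul_eq_zero.1 h1).resolve_left hc₀
  rw [hG_def] at hst
  exact star_eq_zero.1 hst

end Summit.QuantumFields.YangMills.Theorems.Prop7WilsonHessianSectorRows

end
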